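import Summits.QuantumFields.YangMills.Theorems.HypercubicLimit.Negative.NonabelianLoadBearing

/-!
# `HypercubicLimit` (weak-coupling re-type, item `stmt-QuantumFields-16154`) — negative-side support:
# the junk witness is gone; without non-triviality the crux is exactly the weak-coupling lattice gap

Support file for crux `stmt-QuantumFields-16154` — the re-typed existence leg
`CoincidenceRotationBootstrap.HypercubicLimit` = `MirrorModularBoosts.WeakCouplingHypercubicLimit`
(the 8646 body with the new conjunct `sch.HasWeakCouplingLimit`, `β_k → +∞`) — extracted from the standing
disprover's work file `Cruxes/HypercubicLimit/Disproof.lean` §13.  Every clause is written out verbatim in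
tree vocabulary (no Theses decl is named, no `def` is introduced).

* `weakCoupling_false_without_nonabelian`: the `PUnit` kill of `NonabelianLoadBearing.lean` transfers by
  monotonicity — "compact, connected, linear" instead of `IsCompactSimpleLieGroup` makes the weak-coupling
  statement false already at the level of `HasWeakCouplingLimit ∧ Converges ∧ TwoPointNontrivial`.
* `converges_vacuum_of_c_eq_zero`: with `c ≡ 0` every lattice `n`-point function (`n ≥ 1`) is `0`, so the
  convergence clause holds towards the vacuum family for EVERY `(a_k, β_k, L_k)`.
* `exists_weakClausesWithoutNontriviality_iff_latticeGap`: for each `r`, "some weak-coupling scheme and some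
  family satisfy every clause of the crux except the two non-triviality clauses" ⇔ "some weak-coupling
  scheme carries `HasLatticeMassGap` at a positive rate".  In the 8646 body the left side was a THEOREM
  (vacuum family + `β ≡ 0` scheme, the lattice gap being free at `β = 0`); under the re-type the junk
  witness fails `HasWeakCouplingLimit` (`SpeciesScheme.not_hasWeakCouplingLimit_zero`) and what is left is
  the infrared problem itself.
* `weakCouplingLatticeGap_iff_rates`: the scheme packaging stripped — ⇔ some `β_k → +∞`, some half-sides
  `L_k`, some rates `ε_k > 0`, with NO relation among them (the free spacing `a_k := min(ε_k, 1/(k+1))`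
  absorbs every rate at `Δ = 1`, `L'_k := max(L_k, ⌈a_k⁻²⌉)` repairs `a_k L'_k → ∞`), such that every pair
  of local gauge-invariant observables has `k`-uniformly bounded, volume-uniform exponential time clustering
  at rate `ε_k` on all tori of half-side `S ≥ L_k` (`n ≤ S`), eventually in `k`: the uniform lattice mass gap
  at a sequence of arbitrarily weak couplings (open: Chatterjee arXiv:1803.01950 Problem 5.1 along a
  sequence; Jaffe–Witten §5). [folklore]
-/

noncomputable section

open scoped SchwartzMap
open MeasureTheory Filter Topology Complex
open Literature.MathematicalPhysics.AQFT Literature.MathematicalPhysics.QuantumLattice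
open Literature.MathematicalPhysics.QuantumFieldTheory

namespace Summit.QuantumFields.YangMills.Theorems.HypercubicLimit.Negative

section WeakCoupling

variable {G : Type} [Group G] [TopologicalSpace G] [IsTopologicalGroup G] [CompactSpace G]
  [MeasurableSpace G] [BorelSpace G]

/-- **Non-abelianness stays load-bearing for the weak-coupling statement**: weakening
`IsCompactSimpleLieGroup G` to "compact, connected, with a faithful unitary representation" makes the
weak-coupling crux false (`G = PUnit`), already for `HasWeakCouplingLimit ∧ Converges ∧ TwoPointNontrivial`
(drop the new conjunct and apply `hypercubicLimit_false_without_nonabelian`). [folklore] -/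
theorem weakCoupling_false_without_nonabelian :
    ¬ (∀ (G : Type) [Group G] [TopologicalSpace G] [IsTopologicalGroup G] [CompactSpace G],
        ConnectedSpace G → Nonempty (LatticeRep G) →
          letI : MeasurableSpace G := borel G
          haveI : BorelSpace G := ⟨rfl⟩
          ∃ (r : LatticeRep G) (sch : SpeciesScheme (YMSpecies G))
            (S : LabelledSchwingerFamily (YMSpecies G) (EuclideanSpace ℝ (Fin 4))),
            sch.HasWeakCouplingLimit ∧
            (∀ (n : ℕ), n ≠ 0 → ∀ (σ : Fin n → YMSpecies G) (f : Fin n → 𝓢((EuclideanSpace ℝ (Fin 4)), ℝ))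
      (F : 𝓢((Fin n → (EuclideanSpace ℝ (Fin 4))), ℂ)), IsTensorOf F (fun i => ofRealTest (f i)) → IsOffDiagonal F →
        Tendsto (fun k : ℕ => ((latticeSchwinger r.ρ sch (fun s => s.F) k n σ f : ℝ) : ℂ))
          atTop (𝓝 (S n σ F))) ∧
            (∃ (F₁ G₁ : 𝓢((Fin 1 → (EuclideanSpace ℝ (Fin 4))), ℂ)) (H₁ : 𝓢((Fin (1 + 1) → (EuclideanSpace ℝ (Fin 4))), ℂ)),
      IsTimeOrdered F₁ ∧ IsTimeOrdered G₁ ∧ IsAppendTensorOf H₁ (osAdjoint F₁) G₁ ∧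
        S (1 + 1) (fun _ => r.curvature) H₁ ≠ S 1 (fun _ => r.curvature) (osAdjoint F₁) * S 1 (fun _ => r.curvature) G₁)) := by
  intro h
  refine hypercubicLimit_false_without_nonabelian fun G _ _ _ _ hconn hne => ?_
  obtain ⟨r, sch, S, -, hconv, hnt⟩ := h G hconn hne
  exact ⟨r, sch, S, hconv, hnt⟩

/-- **With `c ≡ 0` every lattice `n`-point function (`n ≥ 1`) vanishes**, so the convergence clause holds
towards the vacuum family for EVERY `(a_k, β_k, L_k)` — in particular along a weak-coupling scheme.
[folklore] -/
theorem converges_vacuum_of_c_eq_zero (r : LatticeRep G) (sch : SpeciesScheme (YMSpecies G))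
    (hc : ∀ s k, sch.c s k = 0) :
    ∀ (n : ℕ), n ≠ 0 → ∀ (σ : Fin n → YMSpecies G) (f : Fin n → 𝓢((EuclideanSpace ℝ (Fin 4)), ℝ))
      (F : 𝓢((Fin n → (EuclideanSpace ℝ (Fin 4))), ℂ)), IsTensorOf F (fun i => ofRealTest (f i)) →
        IsOffDiagonal F →
        Tendsto (fun k : ℕ => ((latticeSchwinger r.ρ sch (fun s => s.F) k n σ f : ℝ) : ℂ))
          atTop (𝓝 ((OSData.vacuum (YMSpecies G) 4).schwinger n σ F)) := by
  intro n hn σ f F _ _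
  have hS : (OSData.vacuum (YMSpecies G) 4).schwinger n σ F = 0 := by
    simp [OSData.vacuum, LabelledSchwingerFamily.trivial_of_ne_zero (YMSpecies G) hn]
  rw [hS]
  refine tendsto_const_nhds.congr' (Eventually.of_forall fun k => ?_)
  show (0 : ℂ) = ((latticeSchwinger r.ρ sch (fun s => s.F) k n σ f : ℝ) : ℂ)
  obtain ⟨j, rfl⟩ := Nat.exists_eq_succ_of_ne_zero hn
  simp [latticeSchwinger, smearedLatticeField, hc]

/-- **The weak-coupling crux minus both non-triviality clauses is EXACTLY the weak-coupling lattice gap**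
(for each faithful `r`).  Left: some scheme AT WEAK COUPLING and some labelled family satisfy E0
(normalisation, hermiticity), E0', E2, E3, E4, translation and proper-hypercubic invariance on `⁰𝒮`,
the convergence clause, and the two gap clauses with a common positive rate — every clause of the crux
except non-triviality and non-Gaussianity of the curvature.  Right: some scheme at weak coupling carries
`HasLatticeMassGap` at a positive rate.  (→) is projection; (←) resets the renormalisations to zero (the
gap clause reads `(a_k, β_k, L_k)` only) and takes the vacuum family, whose OS axioms and continuum gap
are free.  Contrast the 8646 body, where the left side holds outright at `β ≡ 0`. [folklore] -/
theorem exists_weakClausesWithoutNontriviality_iff_latticeGap (r : LatticeRep G) :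
    (∃ (sch : SpeciesScheme (YMSpecies G))
        (S : LabelledSchwingerFamily (YMSpecies G) (EuclideanSpace ℝ (Fin 4))),
        sch.HasWeakCouplingLimit ∧
        (S.IsNormalized ∧ S.IsHermitian ∧ S.HasLinearGrowth ∧ S.IsReflectionPositive ∧ S.IsSymmetric ∧
          S.HasClusterProperty ∧
          (∀ (n : ℕ) (k : Fin n → YMSpecies G) (a : EuclideanSpace ℝ (Fin 4))
            (F : 𝓢((Fin n → EuclideanSpace ℝ (Fin 4)), ℂ)), IsOffDiagonal F →
              S n k (translateMulti a F) = S n k F) ∧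
          (∀ (n : ℕ) (k : Fin n → YMSpecies G)
            (R : EuclideanSpace ℝ (Fin 4) ≃ₗᵢ[ℝ] EuclideanSpace ℝ (Fin 4)),
            LinearMap.det (R.toLinearEquiv : EuclideanSpace ℝ (Fin 4) →ₗ[ℝ] EuclideanSpace ℝ (Fin 4)) = 1 →
            (∀ i : Fin 4, ∃ j : Fin 4, R (EuclideanSpace.single i 1) = EuclideanSpace.single j 1 ∨
              R (EuclideanSpace.single i 1) = -EuclideanSpace.single j 1) →
            ∀ F : 𝓢((Fin n → EuclideanSpace ℝ (Fin 4)), ℂ), IsOffDiagonal F →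
              S n k (linActMulti R F) = S n k F)) ∧
        (∀ (n : ℕ), n ≠ 0 → ∀ (σ : Fin n → YMSpecies G) (f : Fin n → 𝓢((EuclideanSpace ℝ (Fin 4)), ℝ))
          (F : 𝓢((Fin n → (EuclideanSpace ℝ (Fin 4))), ℂ)), IsTensorOf F (fun i => ofRealTest (f i)) →
            IsOffDiagonal F →
            Tendsto (fun k : ℕ => ((latticeSchwinger r.ρ sch (fun s => s.F) k n σ f : ℝ) : ℂ))
              atTop (𝓝 (S n σ F))) ∧
        (∃ Δ : ℝ, 0 < Δ ∧ S.HasMassGap Δ ∧ HasLatticeMassGap r sch Δ)) ↔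
      ∃ sch : SpeciesScheme (YMSpecies G), sch.HasWeakCouplingLimit ∧
        ∃ Δ : ℝ, 0 < Δ ∧ HasLatticeMassGap r sch Δ := by
  constructor
  · rintro ⟨sch, S, hw, -, -, Δ, hΔ, -, hlat⟩
    exact ⟨sch, hw, Δ, hΔ, hlat⟩
  · rintro ⟨sch, hw, Δ, hΔ, hlat⟩
    -- reset every renormalisation to zero: same `(a_k, β_k, L_k)`
    let sch₀ : SpeciesScheme (YMSpecies G) := { sch with c := fun _ _ => 0, m := fun _ _ => 0 }
    have hw₀ : sch₀.HasWeakCouplingLimit := hw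
    have hlat₀ : HasLatticeMassGap r sch₀ Δ := hlat
    have h : OSAxiomsSchwinger (OSData.vacuum (YMSpecies G) 4).schwinger :=
      (OSData.vacuum (YMSpecies G) 4).osAxioms
    exact ⟨sch₀, (OSData.vacuum (YMSpecies G) 4).schwinger, hw₀,
      ⟨h.normalized, h.hermitian, h.linearGrowth, h.reflectionPositive, h.symmetric, h.cluster,
        fun n k a F hF => h.invariant.1 n k a F hF, fun n k R hR _ F hF => h.invariant.2 n k R hR F hF⟩,
      converges_vacuum_of_c_eq_zero r sch₀ (fun _ _ => rfl), Δ, hΔ,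
      OSData.vacuum_hasMassGap (ι := YMSpecies G) (d := 4) Δ, hlat₀⟩

/-- **The weak-coupling lattice gap with the scheme packaging stripped.**  For a faithful `r`:
(some species scheme at weak coupling carries `HasLatticeMassGap` at a positive rate) ⇔ there are
couplings `β_k → +∞`, half-sides `L_k` and rates `ε_k > 0` — NO relation among them being required —
such that every pair of local gauge-invariant observables has, with a pair-dependent `k`-uniform constant,
exponential time clustering at rate `ε_k` on every torus of half-side `S ≥ L_k`, for `n ≤ S`, eventually in
`k`.  (→): `ε_k := Δ a_k`.  (←): spacing `a_k := min(ε_k, 1/(k+1))` (so `Δ = 1` and `a_k → 0`), half-side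
`L'_k := max(L_k, ⌈a_k⁻²⌉)` (so `a_k L'_k ≥ a_k⁻¹ → ∞`), `c ≡ m ≡ 0`; the constant is `≥ 0` wherever the
bound is instantiated (`n = 0`).  So the infrared half of the re-typed crux is "a volume-uniform lattice
mass gap at SOME sequence of arbitrarily weak couplings" — nothing more, nothing less. [folklore] -/
theorem weakCouplingLatticeGap_iff_rates (r : LatticeRep G) :
    (∃ sch : SpeciesScheme (YMSpecies G), sch.HasWeakCouplingLimit ∧
        ∃ Δ : ℝ, 0 < Δ ∧ HasLatticeMassGap r sch Δ) ↔
      ∃ (β : ℕ → ℝ) (L : ℕ → ℕ) (ε : ℕ → ℝ), Tendsto β atTop atTop ∧ (∀ k, 0 < ε k) ∧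
        ∀ A B : YMSpecies G, ∃ C : ℝ, ∀ᶠ k in atTop, ∀ S : ℕ, L k ≤ S → ∀ n : ℕ, n ≤ S →
          |latticeConnectedCorr r.ρ (β k) (2 * S + 1) A.F B.F n| ≤ C * Real.exp (-(ε k * n)) := by
  constructor
  · rintro ⟨sch, hw, Δ, hΔ, hlat⟩
    refine ⟨sch.β, sch.L, fun k => Δ * sch.a k, hw, fun k => mul_pos hΔ (sch.a_pos k),
      fun A B => ?_⟩
    obtain ⟨C, hC⟩ := hlat A B
    exact ⟨C, hC.mono fun k hk S hS n hn => by simpa [mul_assoc] using hk S hS n hn⟩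
  · rintro ⟨β, L, ε, hβ, hε, h⟩
    set a : ℕ → ℝ := fun k => min (ε k) ((k : ℝ) + 1)⁻¹ with ha
    have ha_pos : ∀ k, 0 < a k := fun k => lt_min (hε k) (by positivity)
    have ha_le : ∀ k, a k ≤ ε k := fun k => min_le_left _ _
    have ha_tendsto : Tendsto a atTop (𝓝 0) := by
      have h1 : Tendsto (fun k : ℕ => ((k : ℝ) + 1)⁻¹) atTop (𝓝 0) :=
        tendsto_inv_atTop_zero.comp (tendsto_natCast_atTop_atTop.atTop_add tendsto_const_nhds)
      exact squeeze_zero (fun k => (ha_pos k).le) (fun k => min_le_right _ _) h1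
    have hinv : Tendsto (fun k => (a k)⁻¹) atTop atTop :=
      tendsto_inv_nhdsGT_zero.comp
        (tendsto_nhdsWithin_iff.2 ⟨ha_tendsto, Eventually.of_forall fun k => ha_pos k⟩)
    set L' : ℕ → ℕ := fun k => max (L k) ⌈(a k)⁻¹ ^ 2⌉₊ with hL'
    have hL'_tendsto : Tendsto (fun k => a k * (L' k : ℝ)) atTop atTop := by
      refine tendsto_atTop_mono (fun k => ?_) hinv
      have hak := ha_pos k
      calc (a k)⁻¹ = a k * (a k)⁻¹ ^ 2 := by field_simp
        _ ≤ a k * (⌈(a k)⁻¹ ^ 2⌉₊ : ℕ) := mul_le_mul_of_nonneg_left (Nat.le_ceil _) hak.le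
        _ ≤ a k * (L' k : ℝ) :=
            mul_le_mul_of_nonneg_left (by rw [hL']; exact_mod_cast le_max_right _ _) hak.le
    refine ⟨{ a := a, a_pos := ha_pos, tendsto_a := ha_tendsto, β := β, L := L',
              tendsto_L := hL'_tendsto, c := fun _ _ => 0, m := fun _ _ => 0 }, hβ, 1, one_pos,
      fun A B => ?_⟩
    obtain ⟨C, hC⟩ := h A B
    refine ⟨C, hC.mono fun k hk S hS n hn => ?_⟩
    have hS' : L k ≤ S := (le_max_left _ _).trans hS
    have hC0 : 0 ≤ C := by
      have h0 := hk S hS' 0 (Nat.zero_le _)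
      simp only [Nat.cast_zero, mul_zero, neg_zero, Real.exp_zero, mul_one] at h0
      exact (abs_nonneg _).trans h0
    refine (hk S hS' n hn).trans (mul_le_mul_of_nonneg_left (Real.exp_le_exp.2 ?_) hC0)
    have hn0 : (0 : ℝ) ≤ n := Nat.cast_nonneg _
    show -(ε k * n) ≤ -(1 * (a k * n))
    nlinarith [ha_le k]

end WeakCoupling

end Summit.QuantumFields.YangMills.Theorems.HypercubicLimit.Negative

end
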